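import Summits.CriticalPhenomena.PercolationContinuityZ3.Theorems.PercNonProliferationSubpolynomialBlockingStubEnclosureOfBlocking
import HarnessLib

/-!
# Crux `PercNonProliferation.SubpolynomialBlocking` (stmt-CriticalPhenomena-4446), line `root-trick-wall-patch` — stub `stub_enclosureOfBlockingRatio`

Helper file for the lead's skeleton of the line `root-trick-wall-patch` of the crux
`Summit.CriticalPhenomena.PercolationContinuityZ3.Theses.PercNonProliferation.SubpolynomialBlocking`.
Proves exactly the registered stub signature `stub_enclosureOfBlockingRatio`; lands with
`--supports stmt-CriticalPhenomena-4446`.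

## The statement (necessity at aspect ratio `R`: `u^{(R)}_{⌈r/2⌉} ≤ h r` when `R ⌈r/2⌉ ≤ 4r`)

At `p = p_c(ℤ³)` let
`u^{(R)}_m = P(¬ ∃ x ∈ Λ_m, ∃ y ∈ ∂ⁱⁿΛ_{Rm}, x ⟷ y in Λ_{Rm})` be the ratio-`R` blocking probability
(`Λ_k = box 3 k = [-k, k]³`), and let `h r = P((openCrossing (hsBall r) (patch r) (farFace r))ᶜ)` be
the wall-patch enclosure probability, where `patch r = {0} × [0, r)²`,
`hsBall r = [0, 4r] × [-4r, 5r-1]²` (the order interval `Set.Icc ![0, -4r, -4r] ![4r, 5r-1, 5r-1]` of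
`Site 3 = Fin 3 → ℤ`) and `farFace r` is the set of points of `hsBall r` with `x₀ = 4r` or a lateral
coordinate at an extreme value `-4r`, `5r-1`. Then `u^{(R)}_m ≤ h r` for `m = ⌈r/2⌉ = (r+1)/2`,
whenever `R ≥ 2`, `r ≥ 1` and `R m ≤ 4 r`. (The case `R = 2` is the landed
`stub_enclosureOfBlocking`.)

## The argument

Put `L = R m`, `v = (0, ⌊r/2⌋, ⌊r/2⌋)` and `τ = zdShiftIso v` (`τ z = z + v`).
* GEOMETRY (`omega`): `patch r ⊆ τ '' Λ_m ⊆ τ '' Λ_{L-1}` (`m < L` as `R ≥ 2`, `m ≥ 1`) and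
  `farFace r ∩ τ '' Λ_{L-1} = ∅` (every point of the far face is at sup-distance `≥ 4r ≥ L` from `v`:
  `⌊r/2⌋ + 4r ≥ L`, `5r - 1 - ⌊r/2⌋ ≥ 4r ≥ L`).
* DETERMINISTIC (`StubEnclosureOfBlockingRatio.not_mem_openCrossing`): if `ω ⊆ E(ℤ³)` has no open
  path inside `τ '' Λ_L` from `τ '' Λ_m` to `τ '' ∂ⁱⁿΛ_L`, then it has no open path inside `hsBall r`
  from `patch r` to `farFace r`: such a path is a lattice walk (`exists_walk_of_mem_openConnIn`)
  starting in `τ '' Λ_{L-1}` and ending outside it; its maximal initial segment inside `τ '' Λ_{L-1}`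
  followed by the exit edge `f ∼ g` (`exists_prefix_exit_edge`) is an open walk inside `τ '' Λ_L`
  ending at `g` with `g - v ∈ Λ_L ∖ Λ_{L-1}` (`DCT16.mem_box_succ_of_adj`), i.e. `g - v ∈ ∂ⁱⁿΛ_L`
  (`DCT16.mem_innerBoundary_box_of_natAbs_eq`) — a shifted ratio-`R` crossing
  (`mem_openConnIn_of_walk`). Unlike the ratio-`2` case the far face may TOUCH `τ '' Λ_L`
  (`L = 4r`), which is why the first exit is taken from the strict interior `τ '' Λ_{L-1}`.
* MEASURE: `DCT16.real_mono_of_forall_subset_edgeSet` turns the inclusion into an inequality of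
  probabilities, and the shifted blocking event has the probability of the unshifted one by
  invariance of `P_p` under the lattice translation `τ`
  (`StubSixSlab.real_compl_openCrossing_image`; Grimmett 1999 §1.6); the unshifted complement is the
  set of the signature definitionally (`StubEnclosureOfBlockingRatio.real_compl_openCrossing_shift_eq`).

No new definitions; all sets are written exactly as in the registered signature.
-/

noncomputable section

namespace Summit.CriticalPhenomena.PercolationContinuityZ3.Theorems.SubpolynomialBlocking

open MeasureTheory Filter Topology
open Literature.Probability.Percolation Literature.Probability.LatticeModels

namespace StubEnclosureOfBlockingRatio

/-- **The shifted ratio-`R` annulus separates the patch from the far face** (deterministic, lattice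
configurations). With `m = (r+1)/2 < L ≤ 4r`, `v = (0, ⌊r/2⌋, ⌊r/2⌋)`, `τ = zdShiftIso v`: if
`ω ⊆ E(ℤ³)` has no open path inside `τ '' Λ_L` from `τ '' Λ_m` to `τ '' ∂ⁱⁿΛ_L`, then `ω` has no open
path inside `hsBall r` from `patch r` to `farFace r` (first exit of the open lattice walk from the
strict interior `τ '' Λ_{L-1}`; the exit vertex is a translate of an inner-boundary vertex of `Λ_L`). -/
theorem not_mem_openCrossing {r L : ℕ} {ω : BondConfig (Site 3)}
    (hmL : (r + 1) / 2 < L) (hLr : L ≤ 4 * r) (hω : ω ⊆ (zdGraph 3).edgeSet)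
    (h : ω ∉ openCrossing
        ((zdShiftIso (![0, ((r / 2 : ℕ) : ℤ), ((r / 2 : ℕ) : ℤ)] : Site 3)) ''
          (↑(box 3 L) : Set (Site 3)))
        ((zdShiftIso (![0, ((r / 2 : ℕ) : ℤ), ((r / 2 : ℕ) : ℤ)] : Site 3)) ''
          (↑(box 3 ((r + 1) / 2)) : Set (Site 3)))
        ((zdShiftIso (![0, ((r / 2 : ℕ) : ℤ), ((r / 2 : ℕ) : ℤ)] : Site 3)) ''
          (↑(innerBoundary (zdGraph 3) (box 3 L)) : Set (Site 3)))) :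
    ω ∉ openCrossing
        (Set.Icc (![0, -(4 * (r : ℤ)), -(4 * (r : ℤ))] : Site 3)
          ![4 * (r : ℤ), 5 * (r : ℤ) - 1, 5 * (r : ℤ) - 1])
        {x : Site 3 | x 0 = 0 ∧ 0 ≤ x 1 ∧ x 1 < (r : ℤ) ∧ 0 ≤ x 2 ∧ x 2 < (r : ℤ)}
        {y : Site 3 | y ∈ Set.Icc (![0, -(4 * (r : ℤ)), -(4 * (r : ℤ))] : Site 3)
            ![4 * (r : ℤ), 5 * (r : ℤ) - 1, 5 * (r : ℤ) - 1] ∧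
          (y 0 = 4 * (r : ℤ) ∨ y 1 = -(4 * (r : ℤ)) ∨ y 1 = 5 * (r : ℤ) - 1 ∨
            y 2 = -(4 * (r : ℤ)) ∨ y 2 = 5 * (r : ℤ) - 1)} := by
  rw [mem_openCrossing_iff]
  rintro ⟨x, ⟨hx0, hx1, hx1', hx2, hx2'⟩, y, ⟨-, hy⟩, hxy⟩
  obtain ⟨P, -, hPω⟩ := exists_walk_of_mem_openConnIn hω hxy
  obtain ⟨K, rfl⟩ : ∃ K, L = K + 1 := ⟨L - 1, by omega⟩
  set a : ℤ := ((r / 2 : ℕ) : ℤ) with ha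
  set m : ℕ := (r + 1) / 2 with hm
  have har : 2 * (r / 2) ≤ r ∧ r < 2 * (r / 2) + 2 := by omega
  have hmr : 2 * m ≤ r + 1 ∧ r < 2 * m + 1 := by omega
  -- `x ∈ τ '' Λ_K` and `y ∉ τ '' Λ_K` (`m ≤ K`, `K < 4r ≤ ‖y - v‖_∞`).
  have hxS : x ∈ (zdShiftIso (![0, a, a] : Site 3)) '' (↑(box 3 K) : Set (Site 3)) := by
    rw [StubEnclosureOfBlocking.mem_image_box_iff]
    omega
  have hyS : y ∉ (zdShiftIso (![0, a, a] : Site 3)) '' (↑(box 3 K) : Set (Site 3)) := by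
    rw [StubEnclosureOfBlocking.mem_image_box_iff]
    omega
  -- FIRST EXIT from `τ '' Λ_K` through a lattice edge `f ∼ g` of the walk: `g - v ∈ Λ_{K+1} ∖ Λ_K`.
  obtain ⟨f, g, hfS, hgS, hadj, hfgP, -, P', -, hP'e, hP'S⟩ := exists_prefix_exit_edge _ P hxS hyS
  have hfK : f - ![0, a, a] ∈ box 3 K := (StubEnclosureOfBlocking.mem_image_coe_iff _ f _).1 hfS
  have hgK : g - ![0, a, a] ∉ box 3 K := fun hg =>
    hgS ((StubEnclosureOfBlocking.mem_image_coe_iff _ g _).2 hg)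
  have hgK1 : g - ![0, a, a] ∈ box 3 (K + 1) :=
    DCT16.mem_box_succ_of_adj hfK ((StubEnclosureOfBlocking.adj_sub_iff _ f g).2 hadj)
  refine h ⟨x, ?_, g, ?_, mem_openConnIn_of_walk (P'.concat hadj) ?_ ?_⟩
  · -- `x ∈ τ '' Λ_m`
    rw [StubEnclosureOfBlocking.mem_image_box_iff]
    omega
  · -- `g ∈ τ '' ∂ⁱⁿΛ_{K+1}`: a coordinate of `g - v` has absolute value `K + 1`.
    rw [StubEnclosureOfBlocking.mem_image_coe_iff]
    rw [mem_box, not_forall] at hgK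
    obtain ⟨i, hi⟩ := hgK
    refine DCT16.mem_innerBoundary_box_of_natAbs_eq hgK1 (i := i) ?_
    have hi' := (mem_box.1 hgK1) i
    push_cast at hi'
    omega
  · -- the walk `P' · (f ∼ g)` stays inside `τ '' Λ_{K+1}`
    intro z hz
    rw [SimpleGraph.Walk.support_concat, List.mem_append, List.mem_singleton] at hz
    rcases hz with hz | rfl
    · exact (StubEnclosureOfBlocking.mem_image_coe_iff _ z _).2
        (box_mono 3 (Nat.le_succ K) ((StubEnclosureOfBlocking.mem_image_coe_iff _ z _).1 (hP'S z hz)))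
    · exact (StubEnclosureOfBlocking.mem_image_coe_iff _ _ _).2 hgK1
  · -- its edges are edges of the open walk `P`
    intro e he
    rw [SimpleGraph.Walk.edges_concat, List.concat_eq_append, List.mem_append,
      List.mem_singleton] at he
    rcases he with he | rfl
    · exact hPω e (hP'e e he)
    · exact hPω _ hfgP

/-- **The shifted ratio-`R` blocking event has probability `u^{(R)}_m`**: invariance of `P_p` under the
lattice translation `τ = zdShiftIso v` (`StubSixSlab.real_compl_openCrossing_image`, Grimmett 1999
§1.6); the unshifted complement `(openCrossing ↑Λ_n ↑Λ_m ↑(∂ⁱⁿΛ_n))ᶜ` is the blocking set written with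
a negated existential, definitionally. -/
theorem real_compl_openCrossing_shift_eq (p : unitInterval) (v : Site 3) (m n : ℕ) :
    (bondPercolation (zdGraph 3) p).real
        (openCrossing ((zdShiftIso v) '' (↑(box 3 n) : Set (Site 3)))
          ((zdShiftIso v) '' (↑(box 3 m) : Set (Site 3)))
          ((zdShiftIso v) '' (↑(innerBoundary (zdGraph 3) (box 3 n)) : Set (Site 3))))ᶜ =
      (bondPercolation (zdGraph 3) p).real
        {ω | ¬ ∃ x ∈ box 3 m, ∃ y ∈ innerBoundary (zdGraph 3) (box 3 n),
            ω ∈ openConnIn (↑(box 3 n) : Set (Site 3)) x y} := by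
  rw [StubSixSlab.real_compl_openCrossing_image]
  rfl

end StubEnclosureOfBlockingRatio

/-- **Registered stub `stub_enclosureOfBlockingRatio`** (line `root-trick-wall-patch`, crux
`SubpolynomialBlocking`): NECESSITY AT ASPECT RATIO `R`, `u^{(R)}_{⌈r/2⌉} ≤ h r` for `R ≥ 2`, `r ≥ 1`,
`R ⌈r/2⌉ ≤ 4r`, where `u^{(R)}_m = P_{p_c}(¬ ∃ x ∈ Λ_m, ∃ y ∈ ∂ⁱⁿΛ_{Rm}, x ⟷ y in Λ_{Rm})` and
`h r = P_{p_c}((openCrossing (hsBall r) (patch r) (farFace r))ᶜ)` is the critical wall-patch enclosure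
probability (`patch r = {0} × [0,r)²`, `hsBall r = [0,4r] × [-4r,5r-1]²`, `farFace r` the points of
`hsBall r` at depth `4r` or extreme lateral coordinate). Proof: the translate by
`v = (0, ⌊r/2⌋, ⌊r/2⌋)` of the annulus `Λ_{Rm} ∖ Λ_m`, `m = ⌈r/2⌉`, contains the patch in its hole and
its strict interior misses the far face, so blocking of the translated annulus (probability
`u^{(R)}_m` by translation invariance, `StubEnclosureOfBlockingRatio.real_compl_openCrossing_shift_eq`)
forces the enclosure event on lattice configurations (first-exit argument,
`StubEnclosureOfBlockingRatio.not_mem_openCrossing`); `DCT16.real_mono_of_forall_subset_edgeSet`. -/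
theorem stub_enclosureOfBlockingRatio :
    ∀ R r : ℕ, 2 ≤ R → 1 ≤ r → R * ((r + 1) / 2) ≤ 4 * r →
      (bondPercolation (zdGraph 3) (criticalProbI 3)).real
          {ω | ¬ ∃ x ∈ box 3 ((r + 1) / 2),
              ∃ y ∈ innerBoundary (zdGraph 3) (box 3 (R * ((r + 1) / 2))),
                ω ∈ openConnIn (↑(box 3 (R * ((r + 1) / 2))) : Set (Site 3)) x y} ≤
        (bondPercolation (zdGraph 3) (criticalProbI 3)).real
          (openCrossing
            (Set.Icc (![0, -(4 * (r : ℤ)), -(4 * (r : ℤ))] : Site 3)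
              ![4 * (r : ℤ), 5 * (r : ℤ) - 1, 5 * (r : ℤ) - 1])
            {x : Site 3 | x 0 = 0 ∧ 0 ≤ x 1 ∧ x 1 < (r : ℤ) ∧ 0 ≤ x 2 ∧ x 2 < (r : ℤ)}
            {y : Site 3 | y ∈ Set.Icc (![0, -(4 * (r : ℤ)), -(4 * (r : ℤ))] : Site 3)
                ![4 * (r : ℤ), 5 * (r : ℤ) - 1, 5 * (r : ℤ) - 1] ∧
              (y 0 = 4 * (r : ℤ) ∨ y 1 = -(4 * (r : ℤ)) ∨ y 1 = 5 * (r : ℤ) - 1 ∨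
                y 2 = -(4 * (r : ℤ)) ∨ y 2 = 5 * (r : ℤ) - 1)})ᶜ := by
  intro R r hR hr hRr
  have hmL : (r + 1) / 2 < R * ((r + 1) / 2) := lt_mul_of_one_lt_left (by omega) (by omega)
  rw [← StubEnclosureOfBlockingRatio.real_compl_openCrossing_shift_eq (criticalProbI 3)
    (![0, ((r / 2 : ℕ) : ℤ), ((r / 2 : ℕ) : ℤ)] : Site 3) ((r + 1) / 2) (R * ((r + 1) / 2))]
  exact DCT16.real_mono_of_forall_subset_edgeSet (zdGraph 3) (criticalProbI 3) fun ω hω hA =>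
    StubEnclosureOfBlockingRatio.not_mem_openCrossing hmL hRr hω hA

end Summit.CriticalPhenomena.PercolationContinuityZ3.Theorems.SubpolynomialBlocking

end
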